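import Summits.BirchSwinnertonDyer.BirchSwinnertonDyer.Theorems.ByReductionTypeAtTwoAdditivePotGoodPrintZhaiIrreducible
import Literature.NumberTheory.EllipticCurves.Zhai2016.NonvanishingQuadraticTwistsErratum
import Literature.NumberTheory.EllipticCurves.AgasheRibetStein2006.ManinConstantOptimalCurves
import Literature.NumberTheory.DiophantineGeometry.ConductorExponentLeEightProofs
import Literature.NumberTheory.EllipticCurves.SzpiroLocalDataProofs
import HarnessLib

/-!
# K4 crux `AdditiveRankZeroAtTwo` (19098), child C3″ `AdditivePotGoodLowerHalfAtTwo` (22617): the ZHAI 2016 print road through the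
# CORRECTED statements (arXiv v2, 2017: «with odd Manin constant» — the tree's primed facts `Zhai2016.thm11_…'` / `thm12_…'`),
# the odd Manin constant supplied BY PRINT (Agashe–Ribet–Stein 2006 Thm. 2.6 / Cremona: `c = 1` for optimal curves of level `≤ 130000`)

Cell `bsd-2adic`, seat `bsd-2adic-k4-w2` GEN 6 (prover, explicit unit, no kit); `--supports stmt-BirchSwinnertonDyer-22617 --as helper`;
sequel of `…AdditivePotGoodPrintZhaiIrreducible.lean` (p687292). HONEST FRAMING (D-0036/D-0054): the b2b cell's ERRATUM file
`Zhai2016/NonvanishingQuadraticTwistsErratum.lean` records that Zhai's arXiv v2 adds the STANDING ASSUMPTION «the Manin constant `ν_E`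
is odd» to Thms. 1.1/1.2; the v1 facts consumed by p687292's `zhai11_lower` / `zhai12_lower` are therefore STRONGER than the author's
corrected statements whenever the conductor is EVEN — which is the case for every base of the K4 additive habitat. This file re-keys
the road on the CORRECTED (primed) facts `thm11_ordTwo_LAlg_twist_eq_zero'` / `thm12_ordTwo_LAlg_twist_eq_one'` (one extra binder
`¬ 2 ∣ Dt.c`), and supplies that binder BY PRINT from Agashe–Ribet–Stein 2006 Thm. 2.6 (Cremona's modular-symbol verification
`|c| = 1` for every optimal curve of level `≤ 130000`, the tree's `cremona_abs_maninConstant_eq_one_of_level_le`, GEN 5's `h26`) —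
so the displayed base data are unchanged: the optimality datum (`Dt`, `hopt`) and the record `ord₂(L(V,1)/Ω_∞(V))`; the level
bound `N(V) ≤ 130000` is KERNEL per base (`N ∣ |Δ_min|`, `f₂ ≤ 8`, `f_ℓ ≤ 2` for `ℓ ≥ 5`). Closes nothing at the `∀`-level; nothing
booked; BSD is not proved by any of this.

CONTENTS (0 `def`, 0 `sorry`).
* §1 `not_two_dvd_c_of_level_le` — ARS Thm. 2.6 by name ⇒ `¬ 2 ∣ Dt.c` for an optimal datum of level `≤ 130000`;
  `conductorNorm_factorization_two_le_eight` — `ord₂ N ≤ 8` read on `N = W.conductorNorm ℤ` (tool for the per-base level bound; the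
  bound `ord_ℓ N ≤ 2`, `ℓ ≥ 5`, is the tree's `DepletionAtTwo.factorization_conductorNorm_le_two_of_five_le`).
* §2 `zhai11'_lower`, `printFamilyZhai11'_lower` (Thm. 1.1 corrected; `Δ(V) < 0`), §3 `zhai12'_lower`, `printFamilyZhai12'_lower`
  (Thm. 1.2 corrected; `Δ(V) > 0`, `M > 0`): as in p687292 with the binder `hodd : ¬ 2 ∣ Dt.c`.
* §4 `printFamilyZhai11'_lower_of_level_le` / `printFamilyZhai12'_lower_of_level_le`: `hodd` discharged by print (`h26`) from a
  KERNEL level bound `N(V) ≤ 130000`.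

References: [Zhai2016] Thm. 1.1, Thm. 1.2 and arXiv:1409.0231v2 (standing assumption); [AgasheRibetStein2006] Thm. 2.6;
[BrumerKramer1994] Thm. 6.2; [Silverman1994] IV.10.4; [Miller2011LMS] Def. 1.1.
-/

set_option autoImplicit false
set_option linter.dupNamespace false

noncomputable section

open scoped Classical

open WeierstrassCurve Literature.NumberTheory.EllipticCurves
  Literature.NumberTheory.EllipticCurves.ModularForms
  Literature.NumberTheory.EllipticCurves.Rank1Residual
  Literature.NumberTheory.EllipticCurves.Rank1Residual.Typed
  Literature.NumberTheory.EllipticCurves.CoatesLiTianZhai2015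
  Literature.NumberTheory.EllipticCurves.Zhai2016
  Literature.NumberTheory.EllipticCurves.AgasheRibetStein2006
  Summit.BirchSwinnertonDyer.Rank1Residual
  Summit.BirchSwinnertonDyer.Rank1Residual.P2

namespace Summit.BirchSwinnertonDyer.BirchSwinnertonDyer.Theorems.AddPotGoodPrint

/-! ## §1 The odd Manin constant by print; conductor exponent bounds read on `N` -/

/-- **Odd Manin constant BY PRINT**: for an optimal parametrisation datum `Dt` of a globally minimal elliptic `W` at level
`N ≤ 130000`, Agashe–Ribet–Stein 2006 Thm. 2.6 (Cremona's verification) gives `|c| = 1`, in particular `2 ∤ c`.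
[cite: AgasheRibetStein2006, Thm. 2.6] -/
theorem not_two_dvd_c_of_level_le (h26 : cremona_abs_maninConstant_eq_one_of_level_le) (W : WeierstrassCurve ℚ)
    [W.IsElliptic] [W.IsGloballyMinimal] {N : ℕ} [NeZero N] (Dt : ModularParametrizationData W N)
    (hopt : Zhai2021.IsOptimalDatum W Dt) (hN : N ≤ 130000) : ¬ (2 : ℤ) ∣ Dt.c := by
  intro hdvd
  have h := h26 _ Dt hopt hN
  have h1 : Dt.maninConstant.natAbs = 1 := by
    rw [Int.abs_eq_natAbs] at h; exact_mod_cast h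
  have := Int.natAbs_dvd_natAbs.mpr hdvd
  rw [show Dt.c = Dt.maninConstant from rfl, h1] at this
  norm_num at this

/-- `ord₂ N_W ≤ 8` (Lockhart–Rosen–Silverman / Brumer–Kramer, the tree's `conductorExponent_le_eight_holds`, read on `N`).
[cite: BrumerKramer1994, Thm. 6.2] -/
theorem conductorNorm_factorization_two_le_eight (W : WeierstrassCurve ℚ) [W.IsElliptic] :
    (W.conductorNorm ℤ).factorization 2 ≤ 8 := by
  rw [show (2 : ℕ) = ((⟨2, Nat.prime_two⟩ : Nat.Primes) : ℕ) from rfl, factorization_conductorNorm_primesEquiv_symm]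
  exact conductorExponent_le_eight_holds _ _

/-! ## §2 ROAD from the CORRECTED Thm. 1.1 (`Δ(V) < 0`) -/

/-- **Zhai 2016 Thm. 1.1 (CORRECTED, odd Manin constant) ⇒ `r_an = 0` and the LOWER half at every global minimal model of
`V^{(M)}`.** As `zhai11_lower` (p687292) with the primed fact and the binder `hodd : ¬ 2 ∣ Dt.c`.
[cite: Zhai2016, Thm. 1.1 (arXiv:1409.0231v2 ll. 255–279)] [cite: Miller2011LMS, Def. 1.1] -/
theorem zhai11'_lower (h11 : thm11_ordTwo_LAlg_twist_eq_zero') (hmod : hasEntireLFunction_rat)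
    (V : WeierstrassCurve ℚ) [V.IsElliptic] [V.IsGloballyMinimal] [NeZero (V.conductorNorm ℤ)]
    (Dt : ModularParametrizationData V (V.conductorNorm ℤ)) (hopt : Zhai2021.IsOptimalDatum V Dt) (hodd : ¬ (2 : ℤ) ∣ Dt.c)
    (hΔ : V.Δ < 0) (hirr : haveI : Fact (Nat.Prime 2) := ⟨Nat.prime_two⟩; Irr V 2)
    (hL : ∃ x : ℚ, IsLAlg V x ∧ x ≠ 0 ∧ padicValRat 2 x = 0)
    (F : Type) [Field F] [NumberField F] (hF : IsTwoDivisionField V F)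
    (M : ℤ) (hsq : Squarefree M) (hM4 : M % 4 = 1) (hgcd : Int.gcd M (V.conductorNorm ℤ) = 1)
    (hne : M.natAbs.primeFactors.Nonempty) (hin : ∀ q ∈ M.natAbs.primeFactors, q ≠ 2 ∧ IsInertIn F q)
    (W : WeierstrassCurve ℚ) [W.IsElliptic] [W.IsGloballyMinimal]
    (hW : ∃ C : VariableChange ℚ, C • V.quadraticTwist (M : ℚ) = W) :
    W.analyticRank = 0 ∧ MissingLowerBoundAt W 2 := by
  haveI : Fact (Nat.Prime 2) := ⟨Nat.prime_two⟩
  obtain ⟨⟨x, hx, hx0, hv⟩, -, hfinPt, -⟩ :=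
    h11 V Dt hopt hodd hΔ (card_twoTorsion_eq_one_of_irr V hirr) hL F hF M hsq hM4 hgcd hne hin W hW
  have hM0 : (M : ℚ) ≠ 0 := by exact_mod_cast hsq.ne_zero
  have hΔW : W.Δ < 0 := by
    have hnot : ¬ 0 < W.Δ := fun h' => absurd ((Δ_pos_iff_of_twist V hM0 hW).mpr h') (not_lt.mpr hΔ.le)
    exact lt_of_le_of_ne (not_lt.mp hnot) W.isUnit_Δ.ne_zero
  have hc : (W.baseChange ℝ).numRealComponents = 1 := numRealComponents_eq_one_of_Δ_neg hΔW
  have hirrW : Irr W 2 := (irr_two_iff_of_twist V hM0 hW).mp hirr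
  have htor : padicValNat 2 W.torsionOrder = 0 := padicValNat_torsionOrder_eq_zero_of_irreducible W 2 hirrW
  exact missingLowerBoundAt_two_of_isLAlg hmod W hx hx0 hfinPt (by rw [hv, htor, hc]; simp)

/-- **THE CORRECTED ZHAI-1.1 PRINT ROAD, K4-keyed** (binder `hodd : ¬ 2 ∣ Dt.c` displayed): at EVERY global minimal `W ≅ V^{(M)}`:
`r_an(W) = 0 ∧ Addv W 2 ∧ 0 ≤ ord₂ j(W) ∧ ¬CM ∧ Irr W 2 ∧ MissingLowerBoundAt W 2`. Inputs BY NAME: Zhai 2016 Thm. 1.1 (corrected),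
modularity. BSD is not proved by any of this. [cite: Zhai2016, Thm. 1.1 (arXiv v2)] [cite: Miller2011LMS, Def. 1.1] -/
theorem printFamilyZhai11'_lower (h11 : thm11_ordTwo_LAlg_twist_eq_zero') (hmod : hasEntireLFunction_rat)
    (V : WeierstrassCurve ℚ) [V.IsElliptic] [V.IsGloballyMinimal] [NeZero (V.conductorNorm ℤ)]
    (Dt : ModularParametrizationData V (V.conductorNorm ℤ)) (hopt : Zhai2021.IsOptimalDatum V Dt) (hodd : ¬ (2 : ℤ) ∣ Dt.c)
    (hΔ : V.Δ < 0) (hirr : haveI : Fact (Nat.Prime 2) := ⟨Nat.prime_two⟩; Irr V 2)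
    (hj1 : 1 ≤ padicValRat 2 V.j) (hj11 : padicValRat 2 V.j ≤ 11) (hcm : ¬ V.HasCM)
    (hL : ∃ x : ℚ, IsLAlg V x ∧ x ≠ 0 ∧ padicValRat 2 x = 0)
    (F : Type) [Field F] [NumberField F] (hF : IsTwoDivisionField V F)
    (M : ℤ) (hsq : Squarefree M) (hM4 : M % 4 = 1) (hgcd : Int.gcd M (V.conductorNorm ℤ) = 1)
    (hne : M.natAbs.primeFactors.Nonempty) (hin : ∀ q ∈ M.natAbs.primeFactors, q ≠ 2 ∧ IsInertIn F q)
    (W : WeierstrassCurve ℚ) [W.IsElliptic] [W.IsGloballyMinimal]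
    (hW : ∃ C : VariableChange ℚ, C • V.quadraticTwist (M : ℚ) = W) :
    haveI : Fact (Nat.Prime 2) := ⟨Nat.prime_two⟩
    W.analyticRank = 0 ∧ Addv W 2 ∧ 0 ≤ padicValRat 2 W.j ∧ ¬ W.HasCM ∧ Irr W 2 ∧ MissingLowerBoundAt W 2 := by
  haveI : Fact (Nat.Prime 2) := ⟨Nat.prime_two⟩
  have hM0 : (M : ℚ) ≠ 0 := by exact_mod_cast hsq.ne_zero
  obtain ⟨hr, hlow⟩ := zhai11'_lower h11 hmod V Dt hopt hodd hΔ hirr hL F hF M hsq hM4 hgcd hne hin W hW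
  obtain ⟨hadd, hj, hcmW, hirrW⟩ := habitat_twist_of_jWindow V hj1 hj11 hcm hirr hM0 W hW
  exact ⟨hr, hadd, hj, hcmW, hirrW, hlow⟩

/-! ## §3 ROAD from the CORRECTED Thm. 1.2 (`Δ(V) > 0`, `M > 0`) -/

/-- **Zhai 2016 Thm. 1.2 (CORRECTED, odd Manin constant) ⇒ `r_an = 0` and the LOWER half at every global minimal model of
`V^{(M)}`, `M > 0`.** As `zhai12_lower` (p687292) with the primed fact and the binder `hodd : ¬ 2 ∣ Dt.c`.
[cite: Zhai2016, Thm. 1.2 (arXiv:1409.0231v2 Thm. 1.3, ll. 315–321)] [cite: Miller2011LMS, Def. 1.1] -/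
theorem zhai12'_lower (h12 : thm12_ordTwo_LAlg_twist_eq_one') (hmod : hasEntireLFunction_rat)
    (V : WeierstrassCurve ℚ) [V.IsElliptic] [V.IsGloballyMinimal] [NeZero (V.conductorNorm ℤ)]
    (Dt : ModularParametrizationData V (V.conductorNorm ℤ)) (hopt : Zhai2021.IsOptimalDatum V Dt) (hodd : ¬ (2 : ℤ) ∣ Dt.c)
    (hΔ : 0 < V.Δ) (hirr : haveI : Fact (Nat.Prime 2) := ⟨Nat.prime_two⟩; Irr V 2)
    (hL : ∃ x : ℚ, IsLAlg V x ∧ x ≠ 0 ∧ padicValRat 2 x = 1)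
    (F : Type) [Field F] [NumberField F] (hF : IsTwoDivisionField V F)
    (M : ℤ) (hMpos : 0 < M) (hsq : Squarefree M) (hM4 : M % 4 = 1) (hgcd : Int.gcd M (V.conductorNorm ℤ) = 1)
    (hne : M.natAbs.primeFactors.Nonempty) (hin : ∀ q ∈ M.natAbs.primeFactors, q ≠ 2 ∧ IsInertIn F q)
    (W : WeierstrassCurve ℚ) [W.IsElliptic] [W.IsGloballyMinimal]
    (hW : ∃ C : VariableChange ℚ, C • V.quadraticTwist (M : ℚ) = W) :
    W.analyticRank = 0 ∧ MissingLowerBoundAt W 2 := by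
  haveI : Fact (Nat.Prime 2) := ⟨Nat.prime_two⟩
  obtain ⟨⟨x, hx, hx0, hv⟩, -, hfinPt, -⟩ :=
    h12 V Dt hopt hodd hΔ (card_twoTorsion_eq_one_of_irr V hirr) hL F hF M hMpos hsq hM4 hgcd hne hin W hW
  have hM0 : (M : ℚ) ≠ 0 := by exact_mod_cast hsq.ne_zero
  have hΔW : 0 < W.Δ := (Δ_pos_iff_of_twist V hM0 hW).mp hΔ
  have hc : (W.baseChange ℝ).numRealComponents = 2 := numRealComponents_eq_two_of_Δ_pos hΔW
  have hirrW : Irr W 2 := (irr_two_iff_of_twist V hM0 hW).mp hirr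
  have htor : padicValNat 2 W.torsionOrder = 0 := padicValNat_torsionOrder_eq_zero_of_irreducible W 2 hirrW
  have h2 : padicValNat 2 2 = 1 := by simp
  exact missingLowerBoundAt_two_of_isLAlg hmod W hx hx0 hfinPt (by rw [hv, htor, hc, h2]; simp)

/-- **THE CORRECTED ZHAI-1.2 PRINT ROAD, K4-keyed** (`Δ(V) > 0`, `M > 0`; binder `hodd` displayed). Inputs BY NAME: Zhai 2016 Thm. 1.2
(corrected), modularity. BSD is not proved by any of this. [cite: Zhai2016, Thm. 1.2 (arXiv v2 Thm. 1.3)] [cite: Miller2011LMS, Def. 1.1] -/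
theorem printFamilyZhai12'_lower (h12 : thm12_ordTwo_LAlg_twist_eq_one') (hmod : hasEntireLFunction_rat)
    (V : WeierstrassCurve ℚ) [V.IsElliptic] [V.IsGloballyMinimal] [NeZero (V.conductorNorm ℤ)]
    (Dt : ModularParametrizationData V (V.conductorNorm ℤ)) (hopt : Zhai2021.IsOptimalDatum V Dt) (hodd : ¬ (2 : ℤ) ∣ Dt.c)
    (hΔ : 0 < V.Δ) (hirr : haveI : Fact (Nat.Prime 2) := ⟨Nat.prime_two⟩; Irr V 2)
    (hj1 : 1 ≤ padicValRat 2 V.j) (hj11 : padicValRat 2 V.j ≤ 11) (hcm : ¬ V.HasCM)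
    (hL : ∃ x : ℚ, IsLAlg V x ∧ x ≠ 0 ∧ padicValRat 2 x = 1)
    (F : Type) [Field F] [NumberField F] (hF : IsTwoDivisionField V F)
    (M : ℤ) (hMpos : 0 < M) (hsq : Squarefree M) (hM4 : M % 4 = 1) (hgcd : Int.gcd M (V.conductorNorm ℤ) = 1)
    (hne : M.natAbs.primeFactors.Nonempty) (hin : ∀ q ∈ M.natAbs.primeFactors, q ≠ 2 ∧ IsInertIn F q)
    (W : WeierstrassCurve ℚ) [W.IsElliptic] [W.IsGloballyMinimal]
    (hW : ∃ C : VariableChange ℚ, C • V.quadraticTwist (M : ℚ) = W) :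
    haveI : Fact (Nat.Prime 2) := ⟨Nat.prime_two⟩
    W.analyticRank = 0 ∧ Addv W 2 ∧ 0 ≤ padicValRat 2 W.j ∧ ¬ W.HasCM ∧ Irr W 2 ∧ MissingLowerBoundAt W 2 := by
  haveI : Fact (Nat.Prime 2) := ⟨Nat.prime_two⟩
  have hM0 : (M : ℚ) ≠ 0 := by exact_mod_cast hsq.ne_zero
  obtain ⟨hr, hlow⟩ := zhai12'_lower h12 hmod V Dt hopt hodd hΔ hirr hL F hF M hMpos hsq hM4 hgcd hne hin W hW
  obtain ⟨hadd, hj, hcmW, hirrW⟩ := habitat_twist_of_jWindow V hj1 hj11 hcm hirr hM0 W hW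
  exact ⟨hr, hadd, hj, hcmW, hirrW, hlow⟩

/-! ## §4 The odd-Manin binder discharged by print from a kernel level bound -/

/-- **CORRECTED ZHAI-1.1 ROAD with the Manin binder BY PRINT**: as `printFamilyZhai11'_lower`, `¬ 2 ∣ Dt.c` supplied by
Agashe–Ribet–Stein Thm. 2.6 (`h26`) from a level bound `N(V) ≤ 130000` (kernel, per base). Displayed base data: the optimality datum
and the record `ord₂(L(V,1)/Ω_∞(V)) = 0` — exactly as in p687292. [cite: Zhai2016, Thm. 1.1 (arXiv v2)] [cite: AgasheRibetStein2006, Thm. 2.6] -/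
theorem printFamilyZhai11'_lower_of_level_le (h11 : thm11_ordTwo_LAlg_twist_eq_zero')
    (h26 : cremona_abs_maninConstant_eq_one_of_level_le) (hmod : hasEntireLFunction_rat)
    (V : WeierstrassCurve ℚ) [V.IsElliptic] [V.IsGloballyMinimal] [NeZero (V.conductorNorm ℤ)]
    (hN : V.conductorNorm ℤ ≤ 130000)
    (Dt : ModularParametrizationData V (V.conductorNorm ℤ)) (hopt : Zhai2021.IsOptimalDatum V Dt)
    (hΔ : V.Δ < 0) (hirr : haveI : Fact (Nat.Prime 2) := ⟨Nat.prime_two⟩; Irr V 2)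
    (hj1 : 1 ≤ padicValRat 2 V.j) (hj11 : padicValRat 2 V.j ≤ 11) (hcm : ¬ V.HasCM)
    (hL : ∃ x : ℚ, IsLAlg V x ∧ x ≠ 0 ∧ padicValRat 2 x = 0)
    (F : Type) [Field F] [NumberField F] (hF : IsTwoDivisionField V F)
    (M : ℤ) (hsq : Squarefree M) (hM4 : M % 4 = 1) (hgcd : Int.gcd M (V.conductorNorm ℤ) = 1)
    (hne : M.natAbs.primeFactors.Nonempty) (hin : ∀ q ∈ M.natAbs.primeFactors, q ≠ 2 ∧ IsInertIn F q)
    (W : WeierstrassCurve ℚ) [W.IsElliptic] [W.IsGloballyMinimal]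
    (hW : ∃ C : VariableChange ℚ, C • V.quadraticTwist (M : ℚ) = W) :
    haveI : Fact (Nat.Prime 2) := ⟨Nat.prime_two⟩
    W.analyticRank = 0 ∧ Addv W 2 ∧ 0 ≤ padicValRat 2 W.j ∧ ¬ W.HasCM ∧ Irr W 2 ∧ MissingLowerBoundAt W 2 :=
  printFamilyZhai11'_lower h11 hmod V Dt hopt (not_two_dvd_c_of_level_le h26 V Dt hopt hN) hΔ hirr hj1 hj11 hcm hL F hF M hsq
    hM4 hgcd hne hin W hW

/-- **CORRECTED ZHAI-1.2 ROAD with the Manin binder BY PRINT** (`Δ(V) > 0`, `M > 0`), level bound `N(V) ≤ 130000` kernel per base.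
[cite: Zhai2016, Thm. 1.2 (arXiv v2 Thm. 1.3)] [cite: AgasheRibetStein2006, Thm. 2.6] -/
theorem printFamilyZhai12'_lower_of_level_le (h12 : thm12_ordTwo_LAlg_twist_eq_one')
    (h26 : cremona_abs_maninConstant_eq_one_of_level_le) (hmod : hasEntireLFunction_rat)
    (V : WeierstrassCurve ℚ) [V.IsElliptic] [V.IsGloballyMinimal] [NeZero (V.conductorNorm ℤ)]
    (hN : V.conductorNorm ℤ ≤ 130000)
    (Dt : ModularParametrizationData V (V.conductorNorm ℤ)) (hopt : Zhai2021.IsOptimalDatum V Dt)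
    (hΔ : 0 < V.Δ) (hirr : haveI : Fact (Nat.Prime 2) := ⟨Nat.prime_two⟩; Irr V 2)
    (hj1 : 1 ≤ padicValRat 2 V.j) (hj11 : padicValRat 2 V.j ≤ 11) (hcm : ¬ V.HasCM)
    (hL : ∃ x : ℚ, IsLAlg V x ∧ x ≠ 0 ∧ padicValRat 2 x = 1)
    (F : Type) [Field F] [NumberField F] (hF : IsTwoDivisionField V F)
    (M : ℤ) (hMpos : 0 < M) (hsq : Squarefree M) (hM4 : M % 4 = 1) (hgcd : Int.gcd M (V.conductorNorm ℤ) = 1)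
    (hne : M.natAbs.primeFactors.Nonempty) (hin : ∀ q ∈ M.natAbs.primeFactors, q ≠ 2 ∧ IsInertIn F q)
    (W : WeierstrassCurve ℚ) [W.IsElliptic] [W.IsGloballyMinimal]
    (hW : ∃ C : VariableChange ℚ, C • V.quadraticTwist (M : ℚ) = W) :
    haveI : Fact (Nat.Prime 2) := ⟨Nat.prime_two⟩
    W.analyticRank = 0 ∧ Addv W 2 ∧ 0 ≤ padicValRat 2 W.j ∧ ¬ W.HasCM ∧ Irr W 2 ∧ MissingLowerBoundAt W 2 :=
  printFamilyZhai12'_lower h12 hmod V Dt hopt (not_two_dvd_c_of_level_le h26 V Dt hopt hN) hΔ hirr hj1 hj11 hcm hL F hF M hMpos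
    hsq hM4 hgcd hne hin W hW

end Summit.BirchSwinnertonDyer.BirchSwinnertonDyer.Theorems.AddPotGoodPrint

end
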